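import Mathlib
import HarnessLib
import Summits.NavierStokesRegularity.NavierStokesRegularity.Theorems.TaylorModelRungThreeCertificateStageNumericsExit
import Summits.NavierStokesRegularity.NavierStokesRegularity.Theorems.TaylorModelRungThreeCertificateStageNumericsDefect

/-!
# Crux K1b-DR (stmt-NavierStokesRegularity-23954), line `taylor-model` — certificate SOUNDNESS for the
# `StageNumerics` block, part 3: the BILINEAR bound (B) and the assembly `stageNumerics_of_check`

The weighted bilinear bound of the truncated field: for `u, v` in the weighted balls of radii `Nu, Nv` of stage `j`,
`|Qb(u,v)_{ik}| ≤ ½(|qB(u,v)| + |qB(v,u)|) ≤ Nu·Nv·Σ_{(a,b,μ): both factors on the window} |coef|·ω_{k₁}·ω_{k₂}`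
(`sn_qB_le`, the sum is `φ (bilinK)` under `CoefOK φ T`), and `checkSN_bilin` tests `bilinK ≤ bb·ω_k`
(`sn_bilin`). Finally **`stageNumerics_of_check`**: `Monotone φ → CoefOK φ T → checkStageNumerics T A B = true →
(T.toCertData φ).StageNumerics` — the hypothesis `hSN` consumed by `readouts_of_check` (ns-tm-g4) and by the closer.

MODEL-lattice bookkeeping only (rung TL-M3); nothing here concerns the Navier–Stokes equations.
-/

-- the sub-problem namespace repeats the summit name by design (D-0017)
set_option linter.dupNamespace false

namespace Summit.NavierStokesRegularity.NavierStokesRegularity.Theorems.TaylorModelCert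

open scoped BigOperators
open Literature.Analysis.FluidPDE.TaoCascade Literature.Analysis.FluidPDE.TaoCascade.TaylorChain
open Summit.NavierStokesRegularity.NavierStokesRegularity.Theorems.TaylorModelReadout (trunc trunc_apply qB Qb_eq)

namespace CertTables

section Bilin

variable {K : Type} [Field K] [LinearOrder K] {φ : K →+* ℝ} (hφ : Monotone φ) (T : CertTables K)
  {A : ReadoutAux K} {B : StageAux K}
include hφ

/-- The explicit bilinear form `qB` of the truncated field is bounded on weighted balls by `Nu·Nv·φ(bilinK)`.
[folklore] -/
theorem sn_qB_le (hco : T.CoefOK φ) (j : ℕ) (u v : Fin 4 → ℤ → ℝ) {Nu Nv : ℝ}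
    (hu : (T.toCertData φ).InBall j u Nu) (hv : (T.toCertData φ).InBall j v Nv)
    (i : Fin 4) {k : ℤ} (hk : -T.Kb ≤ k ∧ k ≤ T.Ka) :
    |qB (T.toCertData φ) u v i k| ≤ Nu * Nv * φ (T.bilinK j i k) := by
  set d := T.toCertData φ with hd
  have hKb : d.Kb = T.Kb := rfl
  have hKa : d.Ka = T.Ka := rfl
  unfold qB
  rw [hKb, hKa, if_pos hk]
  have hK : Nu * Nv * φ (T.bilinK j i k) = ∑ a ∈ Finset.range 4, ∑ b ∈ Finset.range 4, ∑ μi ∈ Finset.range 4,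
      Nu * Nv * φ (if (-T.Kb ≤ fShell₁ μi k ∧ fShell₁ μi k ≤ T.Ka) ∧ (-T.Kb ≤ fShell₂ μi k ∧ fShell₂ μi k ≤ T.Ka) then
        |T.coefAt ⟨a % 4, Nat.mod_lt _ (by omega)⟩ ⟨b % 4, Nat.mod_lt _ (by omega)⟩ i μi k| *
          T.wShell j (fShell₁ μi k) * T.wShell j (fShell₂ μi k) else 0) := by
    simp only [bilinK, phi_sumN, Finset.mul_sum]
  rw [hK]
  refine sn_abs_sum3_le _ _ fun a ha b hb μi hμ => ?_
  set a' : Fin 4 := ⟨a % 4, Nat.mod_lt _ (by omega)⟩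
  set b' : Fin 4 := ⟨b % 4, Nat.mod_lt _ (by omega)⟩
  have hs1 : k - (shifts.getD μi (0, 0, 0)).2.2 + (shifts.getD μi (0, 0, 0)).1 = fShell₁ μi k := rfl
  have hs2 : k - (shifts.getD μi (0, 0, 0)).2.2 + (shifts.getD μi (0, 0, 0)).2.1 = fShell₂ μi k := rfl
  simp only [trunc_apply]
  rw [hs1, hs2, hKb, hKa]
  have hcoef : d.α a' b' i (shifts.getD μi (0, 0, 0)) * (1 + 1 : ℝ) ^ ((5 : ℝ) * (k - (shifts.getD μi (0, 0, 0)).2.2) / 2) =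
      φ (T.coefAt a' b' i μi k) := by
    rw [hco a' b' i μi k hμ hk.1 hk.2, hd, toCertData_α, shifts_getD μi hμ, if_pos hμ, one_add_one_eq_two]
  by_cases hboth : (-T.Kb ≤ fShell₁ μi k ∧ fShell₁ μi k ≤ T.Ka) ∧ (-T.Kb ≤ fShell₂ μi k ∧ fShell₂ μi k ≤ T.Ka)
  · rw [if_pos hboth, if_pos hboth.1, if_pos hboth.2, hcoef, abs_mul, abs_mul, map_mul, map_mul, phi_abs hφ]
    have h1 := hu a' _ hboth.1.1 hboth.1.2
    have h2 := hv b' _ hboth.2.1 hboth.2.2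
    rw [hd, T.sn_ω φ] at h1 h2
    have hw1 : 0 ≤ Nu * φ (T.wShell j (fShell₁ μi k)) := (abs_nonneg _).trans h1
    calc |φ (T.coefAt a' b' i μi k)| * (|u a' (fShell₁ μi k)| * |v b' (fShell₂ μi k)|)
        ≤ |φ (T.coefAt a' b' i μi k)| * ((Nu * φ (T.wShell j (fShell₁ μi k))) * (Nv * φ (T.wShell j (fShell₂ μi k)))) :=
          mul_le_mul_of_nonneg_left (mul_le_mul h1 h2 (abs_nonneg _) hw1) (abs_nonneg _)
      _ = Nu * Nv * (|φ (T.coefAt a' b' i μi k)| * φ (T.wShell j (fShell₁ μi k)) * φ (T.wShell j (fShell₂ μi k))) := by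
          ring
  · rw [if_neg hboth, map_zero, mul_zero]
    have hzero : (if -T.Kb ≤ fShell₁ μi k ∧ fShell₁ μi k ≤ T.Ka then u a' (fShell₁ μi k) else 0) *
        (if -T.Kb ≤ fShell₂ μi k ∧ fShell₂ μi k ≤ T.Ka then v b' (fShell₂ μi k) else 0) = 0 := by
      rcases not_and_or.1 hboth with h1 | h2
      · rw [if_neg h1, zero_mul]
      · rw [if_neg h2, mul_zero]
    rw [hzero, mul_zero, abs_zero]

/-- Soundness of `checkSN_bilin`: the weighted bilinear bound (B) of `StageNumerics` at stage `j`. [folklore] -/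
theorem sn_bilin (hco : T.CoefOK φ) (j : ℕ) (h : T.checkSN_bilin j = true) :
    0 ≤ (T.toCertData φ).bb j ∧
    ∀ (u v : Fin 4 → ℤ → ℝ) (Nu Nv : ℝ), 0 ≤ Nu → 0 ≤ Nv → (T.toCertData φ).InBall j u Nu →
      (T.toCertData φ).InBall j v Nv →
      (T.toCertData φ).InBall j ((T.toCertData φ).Qb u v) ((T.toCertData φ).bb j * Nu * Nv) := by
  simp only [checkSN_bilin, Bool.and_eq_true, decide_eq_true_eq, allN_eq_true] at h
  obtain ⟨hbb, hrow⟩ := h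
  refine ⟨by rw [toCertData_bb]; exact phi_nonneg hφ hbb, fun u v Nu Nv hNu hNv hu hv i k hk1 hk2 => ?_⟩
  have hk : -T.Kb ≤ k ∧ k ≤ T.Ka := ⟨hk1, hk2⟩
  have hc := hrow (T.idx i k) (T.idx_lt_n i hk)
  rw [T.wi_idx i hk, T.wk_idx i hk] at hc
  have hB1 := T.sn_qB_le hφ hco j u v hu hv i hk
  have hB2 := T.sn_qB_le hφ hco j v u hv hu i hk
  have hω : (T.toCertData φ).ω j k = φ (T.wgt j (T.idx i k)) := T.omega_of_InW φ j i hk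
  have hNN : 0 ≤ Nu * Nv := mul_nonneg hNu hNv
  rw [Qb_eq, hω, toCertData_bb]
  calc |(qB (T.toCertData φ) u v i k + qB (T.toCertData φ) v u i k) / 2|
      = |qB (T.toCertData φ) u v i k + qB (T.toCertData φ) v u i k| / 2 := by
        rw [abs_div, abs_two]
    _ ≤ (Nu * Nv * φ (T.bilinK j i k) + Nv * Nu * φ (T.bilinK j i k)) / 2 := by
        gcongr
        exact (abs_add_le _ _).trans (add_le_add hB1 hB2)
    _ = Nu * Nv * φ (T.bilinK j i k) := by ring
    _ ≤ Nu * Nv * φ ((T.stage j).bb * T.wgt j (T.idx i k)) := mul_le_mul_of_nonneg_left (hφ hc) hNN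
    _ = φ (T.stage j).bb * Nu * Nv * φ (T.wgt j (T.idx i k)) := by rw [map_mul]; ring

end Bilin

/-! ### Assembly -/

section Assembly

variable {K : Type} [Field K] [LinearOrder K] {φ : K →+* ℝ}

/-- **SOUNDNESS OF THE `StageNumerics` CHECKER.** For a monotone ring map `φ : K →+* ℝ` and tables satisfying
the coefficient hypothesis `CoefOK φ T`, a passing `checkStageNumerics T A B` certifies the `StageNumerics` block of
`CertData.Valid` for the interpreted record `T.toCertData φ` (clauses (N), (U), (DIST) per stage `j ≤ N₀` and the
bilinear bound (B)). This is the hypothesis `hSN` of `readouts_of_check`. [folklore] -/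
theorem stageNumerics_of_check (hφ : Monotone φ) (T : CertTables K) (A : ReadoutAux K) (B : StageAux K)
    (hco : T.CoefOK φ) (h : T.checkStageNumerics A B = true) : (T.toCertData φ).StageNumerics := by
  simp only [checkStageNumerics, checkStageNumericsStage, Bool.and_eq_true, allN_eq_true] at h
  obtain ⟨hB, hst⟩ := h
  have hN : (T.toCertData φ).N₀ = T.N₀ := rfl
  refine ⟨fun j hj => ?_, fun j hj => ?_⟩
  · rw [hN] at hj
    obtain ⟨⟨⟨hsc, hex⟩, hdf⟩, -⟩ := hst j (by omega)
    obtain ⟨h1, h2, h3, h4, h5, h6, h7, h8, h9⟩ := T.sn_scalars hφ hB j hsc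
    exact ⟨h1, h2, h3, h4, h5, h6, h7, h8, h9, T.sn_exit hφ hB j hsc hex, T.sn_defect hφ hB hco j hdf⟩
  · rw [hN] at hj
    obtain ⟨-, hbl⟩ := hst j (by omega)
    exact T.sn_bilin hφ hco j hbl

end Assembly

end CertTables

end Summit.NavierStokesRegularity.NavierStokesRegularity.Theorems.TaylorModelCert
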